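import Summits.QuantumFields.QCD.Theorems.EarlyCrosserLaw.Negative.LowerPinLoadBearing
import Summits.QuantumFields.QCD.Theorems.NestedDissectionSeaKineticEdge
import Summits.QuantumFields.QCD.Theorems.NestedDissectionSeaEarlyCrosserLawStubQuasimodeUnionBound
import Summits.QuantumFields.QCD.Theorems.NestedDissectionSeaEarlyCrosserLawMeanCount

/-!
# Normal form of the dilution clause (a′) of the crux `EarlyCrosserLaw` (stmt-QuantumFields-13995)

Line-independent deterministic reduction (lead c3 of the crux, 2026-08-16), serving all three built
lines (`accretive-coarse-jensen`, `kac-rice-hermitian-dos`, `cells-inherit-torus-extinction`).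

Clause (a′) of `Summit.QuantumFields.QCD.Theses.NestedDissectionSea.EarlyCrosserLaw` (the predicate
`EarlyCrosserLawNegative.DilutionClause` of `Negative/LowerPinLoadBearing.lean`, VERBATIM the crux text)
quantifies over EVERY event `E` of gauge fields contained in the cover event "for some flavour `f` and
some bare mass `μ' ≥ m_f(k)`, the corner-`0` window cell or one of its sixteen children is singular at
`μ'`", and bounds the phase-quenched ratio `P(E) = ∫ 1_E wt / ∫ wt` (Bochner conventions) by `δ_j`.
This file proves that (a′) is EQUIVALENT, at the same data `(N_f, reg, b₀, ℓ, m, R)` and with the same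
`δ`, to the single inequality `P(CoverEvent) ≤ δ_j` for ONE closed (hence Borel) event per window box,
in which moreover every crossing carries, for free, the kinematic information of the landed kinetic
edge (`KineticEdge.kineticEdge_zeroMode`): the box is kinematically allowed,
`Σ_i (1 - cos(π/s_i)) ≤ -m_f(k)`, and the crossing mass lies in the compact early interval
`m_f(k) ≤ μ' ≤ -Σ_i (1 - cos(π/s_i))`.

* `EarlyCross U t x s` — the flagged, capped early-crossing event of ONE Dirichlet cell above the
  valence threshold `t`; `earlyCross_of_det_eq_zero` (a bare crossing at `μ' ≥ t` IS such an event,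
  kinetic edge); `earlyCross_iff_flag_and_one_le_realSpecCount` (count form: the flag and
  `1 ≤ realSpecCount (wilsonCell U 0 x s) (-t)`, the vocabulary of the mean-count law of line
  `accretive-coarse-jensen`); `isClosed_earlyCross`.
* `CoverEvent mq s U` — some flavour, the parent `(0, s)` or a child `(halfCorner s c, halfSides s c)`
  has an `EarlyCross`; `coverEvent_of_cover` / `cover_of_coverEvent` (it IS the crux's cover
  hypothesis); `measurableSet_coverEvent`.
* `ratio_mono_of_subset` — `P(E) ≤ P(A)` for ANY `E ⊆ A`, `A` measurable (Bochner conventions: a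
  non-integrable `1_E · wt` integrates to `0`), from the landed finite subadditivity
  `KacRiceHermitianDos.QuasimodeUnionBound.ratio_le_sum`.
* `CoverProbClause` and **`dilutionClause_iff_coverProbClause`** — the normal form of (a′);
  **`earlyCrosserLaw_iff_coverProb`** — the crux, by name, is `∃ reg … CoverProbClause ∧ PinClause ∧
  UpperPin`.

Consequences recorded for the planner: the `∀ E` quantifier of (a′) and the non-measurable-event
corner are harmless (the clause is one probability per box); the kinematic flag and the mass cap that
the line skeletons add to their charged events are not extra hypotheses but part of (a′) itself; and
(a′) is exactly the `P(count ≥ 1)` endpoint of the chain Jensen law ⇒ mean-count law ⇒ (a′)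
(`AccretiveCoarseJensen.dilution_of_meanCountLaw`).  No physics is proved here.
-/

noncomputable section

open scoped BigOperators Classical
open Matrix Complex Filter MeasureTheory Polynomial
open Literature.MathematicalPhysics.QuantumLattice Literature.MathematicalPhysics.QuantumFieldTheory
  Literature.Probability.LatticeModels
open Summit.QuantumFields.QCD.Theses.NestedDissectionSea
open Summit.QuantumFields.QCD.Theorems.EarlyCrosserLawNegative
open Summit.QuantumFields.QCD.Theorems.CoerciveSeaNegative

namespace Summit.QuantumFields.QCD.Cruxes.EarlyCrosserLaw.NormalForm

/-! ## § 1  The flagged early-crossing event of one cell -/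

/-- **Flagged early crossing of the Dirichlet cell `(x, s)` above the valence threshold `t`.**  The box
is kinematically allowed (`Σ_i (1 - cos(π/s_i)) ≤ -t`), and the cell is singular at some bare mass `μ'`
of the compact early interval `t ≤ μ' ≤ -Σ_i (1 - cos(π/s_i))`. [folklore] -/
def EarlyCross {N : ℕ} [NeZero N] (U : GaugeConfig 4 N SU3) (t : ℝ) (x : TorusSite 4 N)
    (s : Fin 4 → ℕ) : Prop :=
  (∑ i, (1 - Real.cos (Real.pi / s i))) ≤ -t ∧
    ∃ μ' : ℝ, t ≤ μ' ∧ μ' + ∑ i, (1 - Real.cos (Real.pi / s i)) ≤ 0 ∧ (wilsonCell U μ' x s).det = 0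

/-- **A bare crossing above the threshold is a flagged early crossing** (the kinetic edge
`KineticEdge.kineticEdge_zeroMode` supplies the flag and the mass cap). [folklore] -/
theorem earlyCross_of_det_eq_zero {N : ℕ} [NeZero N] (U : GaugeConfig 4 N SU3) {t μ' : ℝ}
    (x : TorusSite 4 N) {s : Fin 4 → ℕ} (hs : ∀ i, s i ≤ N) (ht : t ≤ μ')
    (hdet : (wilsonCell U μ' x s).det = 0) : EarlyCross U t x s := by
  have hedge := Summit.QuantumFields.QCD.Theorems.KineticEdge.kineticEdge_zeroMode U s μ' x hs hdet
  exact ⟨hedge.trans (neg_le_neg ht), μ', ht, by linarith, hdet⟩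

/-- Conversely a flagged early crossing is a bare crossing above the threshold. [folklore] -/
theorem exists_det_eq_zero_of_earlyCross {N : ℕ} [NeZero N] {U : GaugeConfig 4 N SU3} {t : ℝ}
    {x : TorusSite 4 N} {s : Fin 4 → ℕ} (h : EarlyCross U t x s) :
    ∃ μ' : ℝ, t ≤ μ' ∧ (wilsonCell U μ' x s).det = 0 := by
  obtain ⟨-, μ', ht, -, hdet⟩ := h
  exact ⟨μ', ht, hdet⟩

/-- **Count form.**  A flagged early crossing above `t` is exactly: the box is kinematically allowed and
the massless cell matrix has a real eigenvalue `≤ -t`, i.e. `1 ≤ realSpecCount (wilsonCell U 0 x s) (-t)`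
(the early-crosser count of the mean-count law, `AccretiveCoarseJensen.meanCount_one_le_realSpecCount`).
[folklore] -/
theorem earlyCross_iff_flag_and_one_le_realSpecCount {N : ℕ} [NeZero N] (U : GaugeConfig 4 N SU3)
    (t : ℝ) (x : TorusSite 4 N) {s : Fin 4 → ℕ} (hs : ∀ i, s i ≤ N) :
    EarlyCross U t x s ↔
      (∑ i, (1 - Real.cos (Real.pi / s i))) ≤ -t ∧ 1 ≤ realSpecCount (wilsonCell U 0 x s) (-t) := by
  constructor
  · rintro ⟨hflag, μ', ht, -, hdet⟩
    exact ⟨hflag, AccretiveCoarseJensen.meanCount_one_le_realSpecCount U x s ht hdet⟩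
  · rintro ⟨hflag, hcount⟩
    rw [← countP_roots_eq_realSpecCount (wilsonCell U 0 x s) (-t), Nat.succ_le_iff,
      Multiset.countP_pos] at hcount
    obtain ⟨u, hu, him, hre⟩ := hcount
    have hu' : -(((-u.re : ℝ)) : ℂ) = u := by
      apply Complex.ext <;> simp [him]
    have hroot : ((wilsonCell U 0 x s).charpoly).eval (-(((-u.re : ℝ)) : ℂ)) = 0 := by
      rw [hu']
      exact (Polynomial.mem_roots (Matrix.charpoly_monic _).ne_zero).1 hu
    have hdet : (wilsonCell U (-u.re) x s).det = 0 :=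
      (AccretiveCoarseJensen.meanCount_det_eq_zero_iff_eval_charpoly U (-u.re) x s).2 hroot
    refine ⟨hflag, -u.re, by linarith, ?_, hdet⟩
    have hedge := Summit.QuantumFields.QCD.Theorems.KineticEdge.kineticEdge_zeroMode U s (-u.re) x hs hdet
    linarith

/-- **The flagged early-crossing event of a cell is closed in the gauge field** (empty if the box is
kinematically forbidden; otherwise the closed superlevel set `{1 ≤ realSpecCount}` of the landed
root-count semicontinuity `AccretiveCoarseJensen.meanCount_isClosed_le_realSpecCount`). [folklore] -/
theorem isClosed_earlyCross {N : ℕ} [NeZero N] (t : ℝ) (x : TorusSite 4 N) {s : Fin 4 → ℕ}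
    (hs : ∀ i, s i ≤ N) : IsClosed {U : GaugeConfig 4 N SU3 | EarlyCross U t x s} := by
  have hset : {U : GaugeConfig 4 N SU3 | EarlyCross U t x s} =
      {U : GaugeConfig 4 N SU3 | (∑ i, (1 - Real.cos (Real.pi / s i))) ≤ -t ∧
        1 ≤ realSpecCount (wilsonCell U 0 x s) (-t)} :=
    Set.ext fun U => earlyCross_iff_flag_and_one_le_realSpecCount U t x hs
  rw [hset]
  by_cases hflag : (∑ i, (1 - Real.cos (Real.pi / s i))) ≤ -t
  · simp only [hflag, true_and]
    exact AccretiveCoarseJensen.meanCount_isClosed_le_realSpecCount x s (-t) 1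
  · simp only [hflag, false_and, Set.setOf_false, isClosed_empty]

/-- Hence it is Borel measurable. [folklore] -/
theorem measurableSet_earlyCross {N : ℕ} [NeZero N] (t : ℝ) (x : TorusSite 4 N) {s : Fin 4 → ℕ}
    (hs : ∀ i, s i ≤ N) : MeasurableSet {U : GaugeConfig 4 N SU3 | EarlyCross U t x s} :=
  (isClosed_earlyCross t x hs).measurableSet

/-! ## § 2  The window cover event (parent box and its sixteen children, all flavours) -/

/-- **The cover event of the window box `s` (corner `0`) at bare masses `mq`**: some flavour `f` has a
flagged early crossing above `mq f` in the parent cell `(0, s)` or in one of its sixteen children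
`(halfCorner s c, halfSides s c)`. [folklore] -/
def CoverEvent {Nf N : ℕ} [NeZero N] (mq : Fin Nf → ℝ) (s : Fin 4 → ℕ) (U : GaugeConfig 4 N SU3) :
    Prop :=
  ∃ f : Fin Nf, EarlyCross U (mq f) 0 s ∨ ∃ c : Fin 4 → Bool, EarlyCross U (mq f) (halfCorner s c) (halfSides s c)

/-- **The crux's cover hypothesis implies the cover event** (flags and caps for free, by the kinetic
edge; the children have sides `halfSides s c ≤ s ≤ N`). [folklore] -/
theorem coverEvent_of_cover {Nf N : ℕ} [NeZero N] {mq : Fin Nf → ℝ} {s : Fin 4 → ℕ}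
    (hs : ∀ i, s i ≤ N) {U : GaugeConfig 4 N SU3}
    (h : ∃ f : Fin Nf, ∃ μ' : ℝ, mq f ≤ μ' ∧ ((wilsonCell U μ' 0 s).det = 0 ∨
      ∃ c : Fin 4 → Bool, (wilsonCell U μ' (halfCorner s c) (halfSides s c)).det = 0)) :
    CoverEvent mq s U := by
  obtain ⟨f, μ', hμ', h0 | ⟨c, hc⟩⟩ := h
  · exact ⟨f, Or.inl (earlyCross_of_det_eq_zero U 0 hs hμ' h0)⟩
  · exact ⟨f, Or.inr ⟨c, earlyCross_of_det_eq_zero U (halfCorner s c)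
      (fun i => (halfSides_le s c i).trans (hs i)) hμ' hc⟩⟩

/-- **… and conversely** (forget the flags). [folklore] -/
theorem cover_of_coverEvent {Nf N : ℕ} [NeZero N] {mq : Fin Nf → ℝ} {s : Fin 4 → ℕ}
    {U : GaugeConfig 4 N SU3} (h : CoverEvent mq s U) :
    ∃ f : Fin Nf, ∃ μ' : ℝ, mq f ≤ μ' ∧ ((wilsonCell U μ' 0 s).det = 0 ∨
      ∃ c : Fin 4 → Bool, (wilsonCell U μ' (halfCorner s c) (halfSides s c)).det = 0) := by
  obtain ⟨f, h0 | ⟨c, hc⟩⟩ := h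
  · obtain ⟨μ', hμ', hdet⟩ := exists_det_eq_zero_of_earlyCross h0
    exact ⟨f, μ', hμ', Or.inl hdet⟩
  · obtain ⟨μ', hμ', hdet⟩ := exists_det_eq_zero_of_earlyCross hc
    exact ⟨f, μ', hμ', Or.inr ⟨c, hdet⟩⟩

/-- **Count form of the cover event**: some flavour's early segment `[0, -mq f]` contains a real
eigenvalue of the massless parent cell or of a massless child cell, in a kinematically allowed box.
[folklore] -/
theorem coverEvent_iff_realSpecCount {Nf N : ℕ} [NeZero N] (mq : Fin Nf → ℝ) {s : Fin 4 → ℕ}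
    (hs : ∀ i, s i ≤ N) (U : GaugeConfig 4 N SU3) :
    CoverEvent mq s U ↔ ∃ f : Fin Nf,
      ((∑ i, (1 - Real.cos (Real.pi / s i))) ≤ -mq f ∧ 1 ≤ realSpecCount (wilsonCell U 0 0 s) (-mq f)) ∨
      ∃ c : Fin 4 → Bool, (∑ i, (1 - Real.cos (Real.pi / halfSides s c i))) ≤ -mq f ∧
        1 ≤ realSpecCount (wilsonCell U 0 (halfCorner s c) (halfSides s c)) (-mq f) := by
  unfold CoverEvent
  refine exists_congr fun f => or_congr (earlyCross_iff_flag_and_one_le_realSpecCount U _ 0 hs)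
    (exists_congr fun c => earlyCross_iff_flag_and_one_le_realSpecCount U _ _
      fun i => (halfSides_le s c i).trans (hs i))

/-- **The cover event is Borel measurable** (a finite union of closed sets). [folklore] -/
theorem measurableSet_coverEvent {Nf N : ℕ} [NeZero N] (mq : Fin Nf → ℝ) {s : Fin 4 → ℕ}
    (hs : ∀ i, s i ≤ N) : MeasurableSet {U : GaugeConfig 4 N SU3 | CoverEvent mq s U} := by
  have hset : {U : GaugeConfig 4 N SU3 | CoverEvent mq s U} =
      ⋃ f : Fin Nf, ({U : GaugeConfig 4 N SU3 | EarlyCross U (mq f) 0 s} ∪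
        ⋃ c : Fin 4 → Bool, {U : GaugeConfig 4 N SU3 | EarlyCross U (mq f) (halfCorner s c) (halfSides s c)}) := by
    ext U
    simp only [CoverEvent, Set.mem_setOf_eq, Set.mem_iUnion, Set.mem_union]
  rw [hset]
  exact MeasurableSet.iUnion fun f => (measurableSet_earlyCross (mq f) 0 hs).union
    (MeasurableSet.iUnion fun c => measurableSet_earlyCross (mq f) (halfCorner s c)
      fun i => (halfSides_le s c i).trans (hs i))

/-! ## § 3  Monotonicity of the phase-quenched ratio (Bochner conventions) -/

/-- **`P(E) ≤ P(A)` for every `E ⊆ A` with `A` measurable**, for the phase-quenched ratio of the odd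
torus `2S+1` at any `β` and bare masses `mq` — with the Bochner conventions of the crux (if `1_E · wt`
is not integrable its integral is `0`).  The one-event case of the landed finite subadditivity
`KacRiceHermitianDos.QuasimodeUnionBound.ratio_le_sum`. [folklore] -/
theorem ratio_mono_of_subset {Nf : ℕ} (S : ℕ) (β : ℝ) (mq : Fin Nf → ℝ)
    (E A : GaugeConfig 4 (2 * S + 1) SU3 → Prop) (hA : MeasurableSet {U | A U})
    (hEA : ∀ U, E U → A U) :
    (∫ U, (if E U then (1 : ℝ) else 0) *
        (∏ f, ‖fermionDet (wilsonDirac (fundamentalRep (Fin 3)) U (mq f) 1)‖)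
      ∂(wilsonMeasure (fundamentalRep (Fin 3)) β : Measure (GaugeConfig 4 (2 * S + 1) SU3))) /
      (∫ U, (∏ f, ‖fermionDet (wilsonDirac (fundamentalRep (Fin 3)) U (mq f) 1)‖)
        ∂(wilsonMeasure (fundamentalRep (Fin 3)) β : Measure (GaugeConfig 4 (2 * S + 1) SU3))) ≤
    (∫ U, (if A U then (1 : ℝ) else 0) *
        (∏ f, ‖fermionDet (wilsonDirac (fundamentalRep (Fin 3)) U (mq f) 1)‖)
      ∂(wilsonMeasure (fundamentalRep (Fin 3)) β : Measure (GaugeConfig 4 (2 * S + 1) SU3))) /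
      (∫ U, (∏ f, ‖fermionDet (wilsonDirac (fundamentalRep (Fin 3)) U (mq f) 1)‖)
        ∂(wilsonMeasure (fundamentalRep (Fin 3)) β : Measure (GaugeConfig 4 (2 * S + 1) SU3))) := by
  have hwt0 : ∀ U : GaugeConfig 4 (2 * S + 1) SU3,
      0 ≤ ∏ f, ‖fermionDet (wilsonDirac (fundamentalRep (Fin 3)) U (mq f) 1)‖ :=
    fun U => Finset.prod_nonneg fun f _ => norm_nonneg _
  have hwtm : Measurable fun U : GaugeConfig 4 (2 * S + 1) SU3 =>
      ∏ f, ‖fermionDet (wilsonDirac (fundamentalRep (Fin 3)) U (mq f) 1)‖ := by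
    simpa only [norm_det_diracMatrix] using measurable_norm_det_diracMatrix (S := 2 * S + 1) mq
  have hwti : Integrable (fun U : GaugeConfig 4 (2 * S + 1) SU3 =>
      ∏ f, ‖fermionDet (wilsonDirac (fundamentalRep (Fin 3)) U (mq f) 1)‖)
      (wilsonMeasure (fundamentalRep (Fin 3)) β : Measure (GaugeConfig 4 (2 * S + 1) SU3)) := by
    simpa only [norm_det_diracMatrix] using integrable_norm_det_diracMatrix (S := 2 * S + 1) mq
      (wilsonMeasure (fundamentalRep (Fin 3)) β : Measure (GaugeConfig 4 (2 * S + 1) SU3))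
  have h := KacRiceHermitianDos.QuasimodeUnionBound.ratio_le_sum
    (wilsonMeasure (fundamentalRep (Fin 3)) β : Measure (GaugeConfig 4 (2 * S + 1) SU3)) _ hwt0 hwtm hwti
    E (fun _ : Unit => A) (fun _ => hA) (fun U hU => ⟨(), hEA U hU⟩)
  simpa only [Finset.univ_unique, Finset.sum_singleton] using h

/-! ## § 4  The normal form of clause (a′) -/

/-- **Clause (a′) in normal form** — window-summable phase-quenched probability of the ONE cover event
per window box: `∀ ε > 0 ∀ᶠ k ∀ S (R ≤ a_k(2S+1)) ∃ δ ≥ 0, Σ_{j<J} δ_j ≤ ε ∧ ∀ j < J ∀ s` (window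
box at scale `j`) `P(CoverEvent (m_·(k)) s) ≤ δ_j`, same data and same `δ` as `DilutionClause`.
[folklore] -/
def CoverProbClause (Nf : ℕ) (reg : QCDRegularisation Nf) (b₀ : ℕ) (ℓ : ℝ) (m : Fin Nf → ℝ)
    (R : ℝ) : Prop :=
  ∀ ε : ℝ, 0 < ε → ∀ᶠ k : ℕ in Filter.atTop, ∀ S : ℕ, R ≤ reg.a k * (2 * S + 1) →
    ∃ δ : ℕ → ℝ, (∀ j, 0 ≤ δ j) ∧
      ∑ j ∈ Finset.range (Nat.log 2 (⌊ℓ / reg.a k⌋₊ / b₀) + 1), δ j ≤ ε ∧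
      ∀ j < Nat.log 2 (⌊ℓ / reg.a k⌋₊ / b₀) + 1, ∀ s : Fin 4 → ℕ,
        (∀ i, b₀ * 2 ^ j ≤ s i ∧ s i < b₀ * 2 ^ (j + 2) ∧ s i ≤ 2 * S + 1 ∧ (s i : ℝ) * reg.a k ≤ ℓ) →
        (∫ U, (if CoverEvent (fun f => reg.mcrit k + reg.a k * m f / reg.Zm k) s U then (1 : ℝ) else 0) *
            (∏ f, ‖fermionDet (wilsonDirac (fundamentalRep (Fin 3)) U
              (reg.mcrit k + reg.a k * m f / reg.Zm k) 1)‖)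
          ∂(wilsonMeasure (fundamentalRep (Fin 3)) (reg.β k) :
            Measure (GaugeConfig 4 (2 * S + 1) SU3))) /
        (∫ U, (∏ f, ‖fermionDet (wilsonDirac (fundamentalRep (Fin 3)) U
              (reg.mcrit k + reg.a k * m f / reg.Zm k) 1)‖)
          ∂(wilsonMeasure (fundamentalRep (Fin 3)) (reg.β k) :
            Measure (GaugeConfig 4 (2 * S + 1) SU3))) ≤ δ j

/-- **NORMAL FORM OF (a′).**  At every data `(N_f, reg, b₀, ℓ, m, R)` the dilution clause (a′) of the
crux (every event inside the cover hypothesis has ratio `≤ δ_j`) is EQUIVALENT to the single inequality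
`P(CoverEvent) ≤ δ_j` per window box — with the same `δ`.  (`→`: take `E := CoverEvent`, forgetting the
flags; `←`: every `E` inside the cover hypothesis lies inside the measurable `CoverEvent` by the kinetic
edge, and the ratio is monotone with the Bochner conventions.) [folklore] -/
theorem dilutionClause_iff_coverProbClause (Nf : ℕ) (reg : QCDRegularisation Nf) (b₀ : ℕ) (ℓ : ℝ)
    (m : Fin Nf → ℝ) (R : ℝ) :
    DilutionClause Nf reg b₀ ℓ m R ↔ CoverProbClause Nf reg b₀ ℓ m R := by
  constructor
  · intro hD ε hε
    filter_upwards [hD ε hε] with k hk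
    intro S hS
    have hk' := hk S hS
    dsimp only at hk'
    obtain ⟨δ, hδ0, hδs, H⟩ := hk'
    refine ⟨δ, hδ0, hδs, fun j hj s hs => ?_⟩
    exact H j hj s hs (CoverEvent (fun f => reg.mcrit k + reg.a k * m f / reg.Zm k) s)
      (fun U hU => cover_of_coverEvent hU)
  · intro hC ε hε
    filter_upwards [hC ε hε] with k hk
    intro S hS
    obtain ⟨δ, hδ0, hδs, H⟩ := hk S hS
    dsimp only
    refine ⟨δ, hδ0, hδs, fun j hj s hs E hE => ?_⟩
    have hsN : ∀ i, s i ≤ 2 * S + 1 := fun i => (hs i).2.2.1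
    calc _ ≤ _ := ratio_mono_of_subset S (reg.β k) (fun f => reg.mcrit k + reg.a k * m f / reg.Zm k) E
          (CoverEvent (fun f => reg.mcrit k + reg.a k * m f / reg.Zm k) s)
          (measurableSet_coverEvent _ hsN) (fun U hU => coverEvent_of_cover hsN (hE U hU))
      _ ≤ δ j := H j hj s hs

/-- **The crux in normal form, by name**: `EarlyCrosserLaw` is — for `N_f ∈ {2,3}` — the existence of
ONE admissible regularisation, `M₀ ≥ 0`, `b₀ ≥ 2`, `ℓ > 0` such that for every mass tuple `m > M₀`
some `R > 0` carries the cover-probability clause, the lower pin (b) and the upper pin (b″). [folklore] -/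
theorem earlyCrosserLaw_iff_coverProb :
    EarlyCrosserLaw ↔ ∀ Nf : ℕ, (Nf = 2 ∨ Nf = 3) → ∃ reg : QCDRegularisation Nf,
      reg.HasMassScaling ∧ (reg.scheme 0 0 0).HasAsymptoticScaling ∧ ∃ M₀ : ℝ, 0 ≤ M₀ ∧ ∃ b₀ : ℕ,
        2 ≤ b₀ ∧ ∃ ℓ : ℝ, 0 < ℓ ∧ ∀ m : Fin Nf → ℝ, (∀ f, M₀ < m f) → ∃ R : ℝ, 0 < R ∧
          CoverProbClause Nf reg b₀ ℓ m R ∧ PinClause Nf reg M₀ m R ∧ UpperPin Nf reg M₀ m R := by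
  rw [earlyCrosserLaw_iff]
  refine forall₂_congr fun Nf _ => exists_congr fun reg => ?_
  unfold EarlyCrosserLawAt
  refine and_congr_right fun _ => and_congr_right fun _ => exists_congr fun M₀ =>
    and_congr_right fun _ => exists_congr fun b₀ => and_congr_right fun _ => exists_congr fun ℓ =>
    and_congr_right fun _ => forall₂_congr fun m _ => exists_congr fun R => and_congr_right fun _ => ?_
  rw [dilutionClause_iff_coverProbClause]

end Summit.QuantumFields.QCD.Cruxes.EarlyCrosserLaw.NormalForm

end
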